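/-
Copyright (c) 2026 the pub-hodgecm-mathlib formalisation cell (harness21).  Prover seat hodgecm-mathlib-LH4-p10 (g8) (valve hand on strike line L1,
LEAD F0P6-plan (g14) BATCH #124 (1)): Track B «K2-LIT», hLiu418 = stmt-HodgeConjecture-24832; organ U1-CT-ind STAGE 3 («U1-glob»), brick B5 of desk
K2E3-p14 (g9)'s census `K2/K2E3-p14/g9/CENSUS-U1glob-Stage3.K2E3-p14-g9.md` §2 — the ARCHIMEDEAN place factor.  THEOREMS ONLY.
-/
import Summits.HodgeConjecture.HodgeConjecture.Theorems.K2LiuHermTwoGammaDefs       -- ★ Φ6a (K2E5-p16): `hermTwoGamma` = `Γ₂(s) = π·Γ(s)·Γ(s−1)`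
import Mathlib.MeasureTheory.Constructions.Pi
import Mathlib.MeasureTheory.Integral.Prod
import HarnessLib

/-!
# Crux `HLiu418`, organ U1-CT-ind STAGE 3 («U1-glob»), brick B5: THE ARCHIMEDEAN PLACE FACTOR OF THE CLEARED SINGULAR BIG-CELL LETTER —
# (I) isolating the arch slot of the Euler head, (Γ) the Γ-prefactor of the rank-one row of Shimura's `ξ₂`-sheet on the scalar `K_∞`-type `k` is
# holomorphic on `{0 < re s}` and VANISHES at `s = ½` for every odd `k` with `|k| ≠ 1`, (K) the arch kernel letters `hFn0` ∕ `ContinuousAt` of ★ B1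

Cell `hodgecm-mathlib`, crux item hLiu418 = `stmt-HodgeConjecture-24832`; squad K2, strike line L1 (valve hand LH4-p10 (g8) from F0∕P3c∕LH4); desk K2E3-p14 (g9)
(B4 END pen), cc R90-C131-p02 (g0) ((K1a-3-arch) ★ `K2LiuRankOneSingularArchRegularity`, (Φ-S2) ★ `K2LiuHermTwoEtaRankOneReduction`), K2E3-p28 (g3) (★ B2b
`K2LiuSingularWhittakerPlaceFactor`).  Lane `--supports stmt-HodgeConjecture-24832 --as helper` (count-neutral).  THEOREMS ONLY (no `def`, no instance, no notation,
no named-fact hypothesis, no `sorry`, default heartbeats).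

THE POINT.  U1-glob's END (★ B1 `K2LiuLocalKernelZeroResidue.resGen_eq_zero_of_localKernel_letters`) takes, for ONE local value `Fn : ℂ → Hv → ℂ`, the place letters
`hfac : ∃ hv G, ContinuousAt G ½ ∧ ContinuousAt (Fn · hv) ½ ∧ ∀ s, 0 < re s → s ≠ ½ → WaStar X j s h = Fn s hv · G s` and `hFn0 : ∀ hv, Fn ½ hv = 0`.  When the place
where U1-glob's local section is killed by the normalised intertwining operator at `½` is ARCHIMEDEAN, the three ingredients are:
* (I) ISOLATION of the arch slot of ★ G1 `K2LiuWhittakerDeltaEulerProduct.whittakerDelta_eq_mul_tprod_euler`'s Euler head — ONE block `A = N_Δ(L ⊗ ℝ)` carrying all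
  real places (`νinf`), against the finite block `⨂_{v∈T} ν_v`: for a head integrand PURE IN THE ARCH SLOT, `F(a, q) = B(a)·R(q)`, the head is
  `(∫ ΨA·B dμA)·(∫ ∏Ψ·R d⨂μ)` (`integral_prod_pi_eq_mul_of_pureArch{,_translate}`, Mathlib `integral_prod_mul`, no integrability hypothesis) — the arch twin of ★ B2b §1
  `integral_prod_pi_eq_mul_of_pureAt` (which isolates a finite `v₀ ∈ T`).  U1-glob's one-real-place clause implies the block clause (`N_{Δ,∞}(½) = ⊗_σ N_{Δ,σ}(½)`).
* (T) TRANSPORT to `{0 < re s}` — NOTHING new: ★ B2b §2 `exists_localKernel_factor_of_letters` is place-agnostic (`Fn :=` the arch value, `hFn` := (K1a-3-arch)).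
* (Γ)+(K) THE ARCH KERNEL.  On the Φ-road of record (K1-a♮ line lead WORD #4 (3)) the archimedean singular (rank-one) row on the scalar `K_∞`-type `k` is Shimura's
  confluent `ξ₂` at a rank-one semidefinite argument: ★ `xiTwo_eq_etaTwo_of_posSemidef` (`ξ₂ = 4π⁴e^{πi(β−α)}·Γ₂(α)⁻¹·Γ₂(β)⁻¹·η₂`) ∘ ★ (Φ-S2) `etaTwo_rankOne_eq`
  (`η₂ = (π/p)e^{−pt}q′^{2−α−β}·Γ(α+β−2)·J`, `J = Γ(β−1)·J̃`, `J̃` entire — R90-C131-p02's ED. 3) at `(α, β) = (s+1+k/2, s+1−k/2)`.  With `Γ₂(z) = π·Γ(z)·Γ(z−1)`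
  the Γ-part collapses to the PREFACTOR `P_k(s) = Γ(2s)·Γ₂(s+1+k/2)⁻¹·Γ(s+1−k/2)⁻¹` (signature (1,0); mirror `P′_k(s) = Γ(2s)·Γ(s+1+k/2)⁻¹·Γ₂(s+1−k/2)⁻¹` for
  signature (0,1)).  §2–§3: `P_k`, `P′_k` are HOLOMORPHIC on `{0 < re s}` (`Γ(2s)` has poles on `re s ≤ 0` only; `1/Γ`, `1/Γ₂` are entire) and VANISH at `s = ½` for every
  odd `k` with `|k| ≠ 1` (`Γ(3/2 − k/2)⁻¹ = 0` for odd `k ≥ 3`, `Γ₂(3/2 + k/2)⁻¹ = 0` for odd `k ≤ −1`, and the mirrors) — and «odd `k`, `|k| ≠ 1`» is EXACTLY U1-glob's arch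
  clause ★ `K2LiuArchNormalisedScalarCont.archNormalisedScalarCont_half_eq_zero` (the continued normalised arch intertwining scalar on the type `k` vanishes at `½`).  So the
  arch kernel is a Γ-fact, not an operator fact.  §4 packages it in ★ B1's letters: `Fn s hv := P s · ω s hv` with `ω(·, hv)` continuous at `½` (the entire rest BY VALUE)
  ⊢ `hFn0` and `ContinuousAt (Fn · hv) ½`.
What this file does NOT do (honest): the identification «arch singular row on type `k` = `P_k ×` (entire × elementary)» — that is (Φ-S2) ED. 3 (R90-C131-p02) composed with
★ `xiTwo_eq_etaTwo_of_posSemidef`; nor the instantiation of §1 at ★ G1's carriers (B4's `hfac :=` line).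
HONEST LABEL.  Count-neutral helper: `HC_CM` is proved only modulo the 7 printed citations (2 remaining named inputs: hLiu418 = `stmt-HodgeConjecture-24832`,
h413 = `stmt-HodgeConjecture-24833`) until rung 0 closes; U1-glob stays OPEN (B2a′ ∕ local reading ∕ B4).

## References
* [Shimura1982] G. Shimura, *Confluent hypergeometric functions on tube domains*, Math. Ann. 260 (1982), (1.29), §4 Thm. 4.2 (the Gamma factors
  `Γ_{m−r}(α+β−κ)·Γ_{m−q}(α)⁻¹·Γ_{m−p}(β)⁻¹` of the rank-`r`, signature-`(p,q)` row).
* [KudlaRallis1994] S. Kudla, S. Rallis, *A regularized Siegel–Weil formula: the first term identity*, Ann. of Math. 140 (1994), §2.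
* [Folland1995] G. Folland, *A Course in Abstract Harmonic Analysis* (1995), §2.2 (product measures, Fubini).
-/

set_option autoImplicit false
set_option linter.dupNamespace false -- the mandated namespace repeats `HodgeConjecture.HodgeConjecture`

noncomputable section

open scoped BigOperators Topology
open MeasureTheory Set Filter Complex
open Summit.HodgeConjecture.HodgeConjecture.Cruxes.HLiu418.K2LiuHermTwoGammaDefs

namespace Summit.HodgeConjecture.HodgeConjecture.Cruxes.HLiu418.K2LiuLocalKernelArchPlaceFactor

/-! ## §1 (I) Isolating the ARCH slot of a product measure `μA ⊗ ⨂_{i∈ι} μ_i` under an integrand pure in the arch slot -/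

section Isolation

variable {ι : Type*} [Fintype ι] {α : ι → Type*} [∀ i, MeasurableSpace (α i)]
  (μ : ∀ i, Measure (α i)) [∀ i, SigmaFinite (μ i)]
  {A : Type*} [MeasurableSpace A] (μA : Measure A) [SigmaFinite μA]

/-- **ISOLATION OF THE ARCH SLOT.**  For the product measure `μA ⊗ ⨂_{i∈ι} μ_i`, a weight `ΨA(a)·∏_i Ψ_i(q_i)` and an integrand PURE IN THE `A`-SLOT,
`F(a, q) = B(a)·R(q)`: `∫ (ΨA(a)·∏_i Ψ_i(q_i))·F(a,q) d(μA ⊗ ⨂_i μ_i) = (∫ ΨA(a)·B(a) dμA(a)) · ∫ (∏_i Ψ_i(q_i))·R(q) d(⨂_i μ_i)`.  No integrability hypothesis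
(both sides take junk values consistently: Mathlib `integral_prod_mul`).  The arch twin of ★ B2b `integral_prod_pi_eq_mul_of_pureAt`; shape of ★ G1's Euler head with
`A := N_Δ(L ⊗ ℝ)` (all real places), `ι := ↥T`. [cite: Folland1995, §2.2] [cite: KudlaRallis1994, §2] -/
theorem integral_prod_pi_eq_mul_of_pureArch (ΨA : A → ℂ) (Ψ : ∀ i, α i → ℂ) (F : A × (∀ i, α i) → ℂ)
    (B : A → ℂ) (R : (∀ i, α i) → ℂ) (hpure : ∀ (a : A) (q : ∀ i, α i), F (a, q) = B a * R q) :
    ∫ z, (ΨA z.1 * ∏ i, Ψ i (z.2 i)) * F z ∂(μA.prod (Measure.pi μ)) =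
      (∫ a, ΨA a * B a ∂μA) * ∫ q, (∏ i, Ψ i (q i)) * R q ∂(Measure.pi μ) := by
  have hfun : (fun z : A × (∀ i, α i) => (ΨA z.1 * ∏ i, Ψ i (z.2 i)) * F z) =
      fun z => (ΨA z.1 * B z.1) * ((∏ i, Ψ i (z.2 i)) * R z.2) := by
    funext z
    rcases z with ⟨a, q⟩
    simp only
    rw [hpure a q]
    ring
  rw [hfun]
  exact integral_prod_mul (fun a => ΨA a * B a) (fun q : (∀ i, α i) => (∏ i, Ψ i (q i)) * R q)

/-- **ISOLATION OF THE ARCH SLOT WITH TWO-SIDED TRANSLATES** (the literal shape of ★ G1's head integrand `(ΨA(a)·∏Ψ_i(q_i))·fT(wA·a·hA, (w_i·q_i·h_i)_i)`):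
for `fT` pure in the arch slot as a function, `fT(a, q) = bA(a)·rT(q)`,
`∫ (ΨA·∏Ψ)·fT(wA·a·hA, (w·q·h)) = (∫ ΨA(a)·bA(wA·a·hA) dμA) · ∫ (∏_i Ψ_i(q_i))·rT((w_i·q_i·h_i)_i) d(⨂μ)`.  No integrability hypothesis.
[cite: Folland1995, §2.2] [cite: KudlaRallis1994, §2] -/
theorem integral_prod_pi_eq_mul_of_pureArch_translate [Mul A] [∀ i, Mul (α i)] (ΨA : A → ℂ) (Ψ : ∀ i, α i → ℂ)
    (fT : A × (∀ i, α i) → ℂ) (bA : A → ℂ) (rT : (∀ i, α i) → ℂ)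
    (hpure : ∀ (a : A) (q : ∀ i, α i), fT (a, q) = bA a * rT q)
    (wA hA : A) (w h : ∀ i, α i) :
    ∫ z, (ΨA z.1 * ∏ i, Ψ i (z.2 i)) * fT (wA * z.1 * hA, fun i => w i * z.2 i * h i) ∂(μA.prod (Measure.pi μ)) =
      (∫ a, ΨA a * bA (wA * a * hA) ∂μA) * ∫ q, (∏ i, Ψ i (q i)) * rT (fun i => w i * q i * h i) ∂(Measure.pi μ) :=
  integral_prod_pi_eq_mul_of_pureArch μ μA ΨA Ψ (fun z => fT (wA * z.1 * hA, fun i => w i * z.2 i * h i))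
    (fun a => bA (wA * a * hA)) (fun q => rT (fun i => w i * q i * h i)) (fun a q => hpure (wA * a * hA) (fun i => w i * q i * h i))

end Isolation

/-! ## §2 (Γ) The Γ-atoms at `s = ½` on the odd scalar `K_∞`-types -/

/-- for odd `k ≥ 3`, `3/2 − k/2 ∈ −ℕ`, so `Γ(3/2 − k/2) = 0` (Mathlib's value at the poles, `Complex.Gamma_neg_nat_eq_zero`) — the zero of
`Γ(s+1−k/2)⁻¹`'s reciprocal partner at `s = ½`, signature `(1,0)`. [cite: Shimura1982, §4 Thm. 4.2] -/
theorem Gamma_threeHalves_sub_half_mul_eq_zero {k : ℤ} (hk : Odd k) (h3 : 3 ≤ k) :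
    Complex.Gamma (3 / 2 - (k : ℂ) / 2) = 0 := by
  obtain ⟨m, rfl⟩ := hk
  obtain ⟨n, rfl⟩ : ∃ n : ℕ, m = (n : ℤ) + 1 := ⟨(m - 1).toNat, by omega⟩
  have h : (3 : ℂ) / 2 - ((2 * ((n : ℤ) + 1) + 1 : ℤ) : ℂ) / 2 = -(n : ℂ) := by
    push_cast
    ring
  rw [h]
  exact Complex.Gamma_neg_nat_eq_zero n

/-- for odd `k ≤ −3`, `3/2 + k/2 ∈ −ℕ`, so `Γ(3/2 + k/2) = 0` — signature `(0,1)` mirror. [cite: Shimura1982, §4 Thm. 4.2] -/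
theorem Gamma_threeHalves_add_half_mul_eq_zero {k : ℤ} (hk : Odd k) (h3 : k ≤ -3) :
    Complex.Gamma (3 / 2 + (k : ℂ) / 2) = 0 := by
  obtain ⟨m, rfl⟩ := hk
  obtain ⟨n, rfl⟩ : ∃ n : ℕ, m = -(n : ℤ) - 2 := ⟨(-m - 2).toNat, by omega⟩
  have h : (3 : ℂ) / 2 + ((2 * (-(n : ℤ) - 2) + 1 : ℤ) : ℂ) / 2 = -(n : ℂ) := by
    push_cast
    ring
  rw [h]
  exact Complex.Gamma_neg_nat_eq_zero n

/-- for odd `k ≤ −1`, `Γ₂(3/2 + k/2) = π·Γ(3/2 + k/2)·Γ(1/2 + k/2) = 0` since `1/2 + k/2 ∈ −ℕ` — the zero of `Γ₂(s+1+k/2)⁻¹`'s partner at `s = ½`,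
signature `(1,0)`. [cite: Shimura1982, (1.29), §4 Thm. 4.2] -/
theorem hermTwoGamma_threeHalves_add_half_mul_eq_zero {k : ℤ} (hk : Odd k) (h1 : k ≤ -1) :
    hermTwoGamma (3 / 2 + (k : ℂ) / 2) = 0 := by
  obtain ⟨m, rfl⟩ := hk
  obtain ⟨n, rfl⟩ : ∃ n : ℕ, m = -(n : ℤ) - 1 := ⟨(-m - 1).toNat, by omega⟩
  rw [hermTwoGamma_def]
  have h : (3 : ℂ) / 2 + ((2 * (-(n : ℤ) - 1) + 1 : ℤ) : ℂ) / 2 - 1 = -(n : ℂ) := by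
    push_cast
    ring
  rw [h, Complex.Gamma_neg_nat_eq_zero, mul_zero]

/-- for odd `k ≥ 1`, `Γ₂(3/2 − k/2) = π·Γ(3/2 − k/2)·Γ(1/2 − k/2) = 0` since `1/2 − k/2 ∈ −ℕ` — signature `(0,1)` mirror. [cite: Shimura1982, (1.29), §4 Thm. 4.2] -/
theorem hermTwoGamma_threeHalves_sub_half_mul_eq_zero {k : ℤ} (hk : Odd k) (h1 : 1 ≤ k) :
    hermTwoGamma (3 / 2 - (k : ℂ) / 2) = 0 := by
  obtain ⟨m, rfl⟩ := hk
  obtain ⟨n, rfl⟩ : ∃ n : ℕ, m = (n : ℤ) := ⟨m.toNat, by omega⟩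
  rw [hermTwoGamma_def]
  have h : (3 : ℂ) / 2 - ((2 * (n : ℤ) + 1 : ℤ) : ℂ) / 2 - 1 = -(n : ℂ) := by
    push_cast
    ring
  rw [h, Complex.Gamma_neg_nat_eq_zero, mul_zero]

/-! ## §3 (Γ) The Γ-prefactor of the rank-one row of the `ξ₂`-sheet on the scalar type `k`: holomorphic on `{0 < re s}`, zero at `½` for odd `|k| ≠ 1` -/

/-- `1/Γ₂` is entire (`Γ₂(z)⁻¹ = π⁻¹·Γ(z)⁻¹·Γ(z−1)⁻¹`, Mathlib `Complex.differentiable_one_div_Gamma`). [cite: Shimura1982, (1.29)] -/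
theorem differentiable_inv_hermTwoGamma : Differentiable ℂ fun z : ℂ => (hermTwoGamma z)⁻¹ := by
  have h : (fun z : ℂ => (hermTwoGamma z)⁻¹) = fun z => ((Real.pi : ℂ))⁻¹ * (Complex.Gamma z)⁻¹ * (Complex.Gamma (z - 1))⁻¹ := by
    funext z
    rw [hermTwoGamma_def, mul_inv, mul_inv]
  rw [h]
  exact ((differentiable_const _).mul Complex.differentiable_one_div_Gamma).mul
    (Complex.differentiable_one_div_Gamma.comp (differentiable_id.sub (differentiable_const _)))

/-- `s ↦ Γ(2s)` is holomorphic on `{0 < re s}` (its poles lie on `re s ≤ 0`). [folklore] -/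
theorem differentiableOn_Gamma_two_mul : DifferentiableOn ℂ (fun s : ℂ => Complex.Gamma (2 * s)) {s : ℂ | 0 < s.re} := by
  intro s hs
  have hne : ∀ m : ℕ, 2 * s ≠ -(m : ℂ) := fun m h => by
    have h1 := congrArg Complex.re h
    simp only [mul_re, neg_re, natCast_re] at h1
    have h2 : (2 : ℂ).re = 2 := rfl
    have h3 : (2 : ℂ).im = 0 := rfl
    rw [h2, h3, zero_mul, sub_zero] at h1
    have h4 : (0 : ℝ) ≤ m := Nat.cast_nonneg m
    have h5 : 0 < s.re := hs
    linarith
  exact ((Complex.differentiableAt_Gamma _ hne).comp s ((differentiableAt_const _).mul differentiableAt_id)).differentiableWithinAt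

/-- **THE Γ-PREFACTOR `P_k(s) = Γ(2s)·Γ₂(s+1+k/2)⁻¹·Γ(s+1−k/2)⁻¹` (rank one, signature `(1,0)`, scalar type `k`) IS HOLOMORPHIC ON `{0 < re s}`** for every `k : ℤ`.
[cite: Shimura1982, §4 Thm. 4.2] [cite: KudlaRallis1994, §2] -/
theorem differentiableOn_xiRankOnePrefactor (k : ℤ) :
    DifferentiableOn ℂ (fun s : ℂ => Complex.Gamma (2 * s) * (hermTwoGamma (s + 1 + (k : ℂ) / 2))⁻¹ * (Complex.Gamma (s + 1 - (k : ℂ) / 2))⁻¹)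
      {s : ℂ | 0 < s.re} := by
  refine (differentiableOn_Gamma_two_mul.mul ?_).mul ?_
  · exact (differentiable_inv_hermTwoGamma.comp ((differentiable_id.add (differentiable_const _)).add (differentiable_const _))).differentiableOn
  · exact (Complex.differentiable_one_div_Gamma.comp ((differentiable_id.add (differentiable_const _)).sub (differentiable_const _))).differentiableOn

/-- **… mirror `P′_k(s) = Γ(2s)·Γ(s+1+k/2)⁻¹·Γ₂(s+1−k/2)⁻¹` (signature `(0,1)`) IS HOLOMORPHIC ON `{0 < re s}`.** [cite: Shimura1982, §4 Thm. 4.2] -/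
theorem differentiableOn_xiRankOnePrefactor' (k : ℤ) :
    DifferentiableOn ℂ (fun s : ℂ => Complex.Gamma (2 * s) * (Complex.Gamma (s + 1 + (k : ℂ) / 2))⁻¹ * (hermTwoGamma (s + 1 - (k : ℂ) / 2))⁻¹)
      {s : ℂ | 0 < s.re} := by
  refine (differentiableOn_Gamma_two_mul.mul ?_).mul ?_
  · exact (Complex.differentiable_one_div_Gamma.comp ((differentiable_id.add (differentiable_const _)).add (differentiable_const _))).differentiableOn
  · exact (differentiable_inv_hermTwoGamma.comp ((differentiable_id.add (differentiable_const _)).sub (differentiable_const _))).differentiableOn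

/-- **THE Γ-PREFACTOR VANISHES AT `s = ½` ON EVERY ODD TYPE `|k| ≠ 1`** (signature `(1,0)`): `P_k(½) = Γ(1)·Γ₂(3/2+k/2)⁻¹·Γ(3/2−k/2)⁻¹ = 0` — for `k ≥ 3` the last
factor is `0⁻¹`, for `k ≤ −3` (indeed `k ≤ −1`) the middle one is.  «odd `k`, `|k| ≠ 1`» is exactly U1-glob's arch clause ★ `archNormalisedScalarCont_half_eq_zero`.
[cite: Shimura1982, §4 Thm. 4.2] [cite: KudlaRallis1994, §2] -/
theorem xiRankOnePrefactor_half_eq_zero {k : ℤ} (hk : Odd k) (h1 : k.natAbs ≠ 1) :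
    Complex.Gamma (2 * (1 / 2 : ℂ)) * (hermTwoGamma (1 / 2 + 1 + (k : ℂ) / 2))⁻¹ * (Complex.Gamma (1 / 2 + 1 - (k : ℂ) / 2))⁻¹ = 0 := by
  have hcases : 3 ≤ k ∨ k ≤ -1 := by
    rcases hk with ⟨m, rfl⟩
    omega
  rcases hcases with h3 | hneg
  · have h : (1 : ℂ) / 2 + 1 - (k : ℂ) / 2 = 3 / 2 - (k : ℂ) / 2 := by ring
    rw [h, Gamma_threeHalves_sub_half_mul_eq_zero hk h3, inv_zero, mul_zero]
  · have h : (1 : ℂ) / 2 + 1 + (k : ℂ) / 2 = 3 / 2 + (k : ℂ) / 2 := by ring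
    rw [h, hermTwoGamma_threeHalves_add_half_mul_eq_zero hk hneg, inv_zero, mul_zero, zero_mul]

/-- **… mirror (signature `(0,1)`): `P′_k(½) = Γ(1)·Γ(3/2+k/2)⁻¹·Γ₂(3/2−k/2)⁻¹ = 0` on every odd type `|k| ≠ 1`.** [cite: Shimura1982, §4 Thm. 4.2] -/
theorem xiRankOnePrefactor'_half_eq_zero {k : ℤ} (hk : Odd k) (h1 : k.natAbs ≠ 1) :
    Complex.Gamma (2 * (1 / 2 : ℂ)) * (Complex.Gamma (1 / 2 + 1 + (k : ℂ) / 2))⁻¹ * (hermTwoGamma (1 / 2 + 1 - (k : ℂ) / 2))⁻¹ = 0 := by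
  have hcases : 1 ≤ k ∨ k ≤ -3 := by
    rcases hk with ⟨m, rfl⟩
    omega
  rcases hcases with hpos | h3
  · have h : (1 : ℂ) / 2 + 1 - (k : ℂ) / 2 = 3 / 2 - (k : ℂ) / 2 := by ring
    rw [h, hermTwoGamma_threeHalves_sub_half_mul_eq_zero hk hpos, inv_zero, mul_zero]
  · have h : (1 : ℂ) / 2 + 1 + (k : ℂ) / 2 = 3 / 2 + (k : ℂ) / 2 := by ring
    rw [h, Gamma_threeHalves_add_half_mul_eq_zero hk h3, inv_zero, mul_zero, zero_mul]

/-! ## §4 (K) The arch kernel letters of ★ B1 from a prefactor that vanishes at `½` -/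

/-- **THE ARCH KERNEL LETTERS FROM A PREFACTOR.**  If on `{0 < re s}` the arch local value factors as `Fn s hv = P s · ω s hv` with `P` holomorphic on `{0 < re s}`,
`P(½) = 0`, and each `ω(·, hv)` continuous at `½` (the entire ∕ elementary rest of the rank-one `ξ₂`-row, BY VALUE), then `Fn ½ hv = 0` for all `hv` (★ B1's `hFn0`)
and each `Fn(·, hv)` is continuous at `½` (★ B1's `hfac` continuity clause). [cite: KudlaRallis1994, §2] [cite: Shimura1982, §4 Thm. 4.2] -/
theorem archKernel_letters_of_prefactor {Hv : Type*} (P : ℂ → ℂ) (ω Fn : ℂ → Hv → ℂ)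
    (hP : DifferentiableOn ℂ P {s : ℂ | 0 < s.re}) (hP0 : P (1 / 2) = 0)
    (hω : ∀ hv, ContinuousAt (fun s => ω s hv) (1 / 2))
    (hFn : ∀ s : ℂ, 0 < s.re → ∀ hv, Fn s hv = P s * ω s hv) :
    (∀ hv, Fn (1 / 2) hv = 0) ∧ ∀ hv, ContinuousAt (fun s => Fn s hv) (1 / 2) := by
  have hhalf : 0 < (1 / 2 : ℂ).re := by norm_num
  refine ⟨fun hv => by rw [hFn _ hhalf hv, hP0, zero_mul], fun hv => ?_⟩
  -- `{0 < re s}` is a neighbourhood of `½` (★ `K2LiuRankOneInnerWhittakerContinued.halfPlane_mem_nhds_half`, kept import-free here as a term)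
  have hnhds : {s : ℂ | 0 < s.re} ∈ 𝓝 (1 / 2 : ℂ) := (isOpen_lt continuous_const Complex.continuous_re).mem_nhds hhalf
  have hPc : ContinuousAt P (1 / 2) := (hP.differentiableAt hnhds).continuousAt
  refine (hPc.mul (hω hv)).congr ?_
  filter_upwards [hnhds] with s hs
  exact (hFn s hs hv).symm

/-- **THE ARCH KERNEL LETTERS ON THE SCALAR TYPE `k`, signature `(1,0)`**: `Fn s hv = P_k(s) · ω s hv` on `{0 < re s}` with `ω(·, hv)` continuous at `½`, `k` odd,
`|k| ≠ 1` ⊢ ★ B1's `hFn0 : ∀ hv, Fn ½ hv = 0` and `∀ hv, ContinuousAt (Fn · hv) ½`. [cite: Shimura1982, §4 Thm. 4.2] [cite: KudlaRallis1994, §2] -/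
theorem archKernel_letters_xiRankOne {k : ℤ} (hk : Odd k) (h1 : k.natAbs ≠ 1) {Hv : Type*} (ω Fn : ℂ → Hv → ℂ)
    (hω : ∀ hv, ContinuousAt (fun s => ω s hv) (1 / 2))
    (hFn : ∀ s : ℂ, 0 < s.re → ∀ hv,
      Fn s hv = Complex.Gamma (2 * s) * (hermTwoGamma (s + 1 + (k : ℂ) / 2))⁻¹ * (Complex.Gamma (s + 1 - (k : ℂ) / 2))⁻¹ * ω s hv) :
    (∀ hv, Fn (1 / 2) hv = 0) ∧ ∀ hv, ContinuousAt (fun s => Fn s hv) (1 / 2) :=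
  archKernel_letters_of_prefactor _ ω Fn (differentiableOn_xiRankOnePrefactor k) (xiRankOnePrefactor_half_eq_zero hk h1) hω hFn

/-- **… signature `(0,1)` mirror**: `Fn s hv = P′_k(s) · ω s hv`. [cite: Shimura1982, §4 Thm. 4.2] [cite: KudlaRallis1994, §2] -/
theorem archKernel_letters_xiRankOne' {k : ℤ} (hk : Odd k) (h1 : k.natAbs ≠ 1) {Hv : Type*} (ω Fn : ℂ → Hv → ℂ)
    (hω : ∀ hv, ContinuousAt (fun s => ω s hv) (1 / 2))
    (hFn : ∀ s : ℂ, 0 < s.re → ∀ hv,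
      Fn s hv = Complex.Gamma (2 * s) * (Complex.Gamma (s + 1 + (k : ℂ) / 2))⁻¹ * (hermTwoGamma (s + 1 - (k : ℂ) / 2))⁻¹ * ω s hv) :
    (∀ hv, Fn (1 / 2) hv = 0) ∧ ∀ hv, ContinuousAt (fun s => Fn s hv) (1 / 2) :=
  archKernel_letters_of_prefactor _ ω Fn (differentiableOn_xiRankOnePrefactor' k) (xiRankOnePrefactor'_half_eq_zero hk h1) hω hFn

/-- **THE ARCH KERNEL LETTERS, FAMILY FORM** (the scalar type may vary with the arch datum: `kof : Hv → ℤ`, every `kof hv` odd with `|kof hv| ≠ 1`; signature `(1,0)`):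
`Fn s hv = P_{kof hv}(s) · ω s hv` on `{0 < re s}` ⊢ ★ B1's `hFn0` and the continuity clause. [cite: Shimura1982, §4 Thm. 4.2] [cite: KudlaRallis1994, §2] -/
theorem archKernel_letters_xiRankOne_family {Hv : Type*} (kof : Hv → ℤ) (hk : ∀ hv, Odd (kof hv)) (h1 : ∀ hv, (kof hv).natAbs ≠ 1) (ω Fn : ℂ → Hv → ℂ)
    (hω : ∀ hv, ContinuousAt (fun s => ω s hv) (1 / 2))
    (hFn : ∀ s : ℂ, 0 < s.re → ∀ hv,
      Fn s hv = Complex.Gamma (2 * s) * (hermTwoGamma (s + 1 + (kof hv : ℂ) / 2))⁻¹ * (Complex.Gamma (s + 1 - (kof hv : ℂ) / 2))⁻¹ * ω s hv) :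
    (∀ hv, Fn (1 / 2) hv = 0) ∧ ∀ hv, ContinuousAt (fun s => Fn s hv) (1 / 2) := by
  have key : ∀ hv, Fn (1 / 2) hv = 0 ∧ ContinuousAt (fun s => Fn s hv) (1 / 2) := fun hv => by
    have h := archKernel_letters_of_prefactor (Hv := Unit) _ (fun s _ => ω s hv) (fun s _ => Fn s hv)
      (differentiableOn_xiRankOnePrefactor (kof hv)) (xiRankOnePrefactor_half_eq_zero (hk hv) (h1 hv)) (fun _ => hω hv) (fun s hs _ => hFn s hs hv)
    exact ⟨h.1 (), h.2 ()⟩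
  exact ⟨fun hv => (key hv).1, fun hv => (key hv).2⟩

/-! ## §5 (K′) The arch kernel from the TOWER letters (the operator road, by value: desk K2E3-p14 (g9)'s cut; the computed scalars are brick B5′) -/

/-- **THE ARCH KERNEL FROM THE NORMALISED GINDIKIN–KARPELEVICH TOWER AT `σ`, BY VALUE.**  Letters on the scalar `K_σ`-type (multiplicity one): `nΔ`, `n1`, `n12` = the
continued normalised scalars of the full Siegel operator `N_{Δ,σ}(s)`, of the rank-one operator `N^{(1)}_σ` (at `s − ½`) and of the two-step word `N_{w₁w₂,σ}(s)`; the cocycle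
`nΔ s = n1 (s − ½) · n12 s` on `{0 < re s}`; the rank-one functional equation at the centre `n1 0 ≠ 0`; U1-glob's arch clause `nΔ ½ = 0` (★ `archNormalisedScalarCont_half_eq_zero`);
the reading `Fn s hv = n12 s · R s hv` of the twisted arch block (two-step scalar × [corner Whittaker at `s − ½` × unit]).  THEN `Fn ½ hv = 0` for every `hv` — ★ B1's `hFn0`
token for token.  (It moves no analysis: `n12`, `hcoc`, `hn1` are letters; their computation is brick B5′ `K2LiuArchTwoStepScalar`.) [cite: KudlaRallis1994, §2]
[cite: Shimura1982, §4 Thm. 4.2] -/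
theorem archKernel_half_eq_zero_of_tower_letters {Hv : Type*} (Fn : ℂ → Hv → ℂ) (nΔ n1 n12 : ℂ → ℂ) (R : ℂ → Hv → ℂ)
    (hcoc : ∀ s : ℂ, 0 < s.re → nΔ s = n1 (s - 1 / 2) * n12 s) (hn1 : n1 0 ≠ 0) (hΔ : nΔ (1 / 2) = 0)
    (hread : ∀ s : ℂ, 0 < s.re → ∀ hv, Fn s hv = n12 s * R s hv) :
    ∀ hv, Fn (1 / 2) hv = 0 := by
  have hhalf : 0 < (1 / 2 : ℂ).re := by norm_num
  have h12 : n12 (1 / 2) = 0 := by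
    have h := hcoc _ hhalf
    rw [hΔ, sub_self] at h
    exact (mul_eq_zero.1 h.symm).resolve_left hn1
  intro hv
  rw [hread _ hhalf hv, h12, zero_mul]

/-- **… and the continuity clause of ★ B1's `hfac`** from the same reading: `n12` continuous at `½` (normalised scalars are holomorphic on `{0 < re s}`) and `R(·, hv)` continuous at `½`
(★ W1-arch ∕ (K1a-3-arch)) ⊢ `ContinuousAt (Fn · hv) ½`. [cite: KudlaRallis1994, §2] -/
theorem continuousAt_half_of_tower_letters {Hv : Type*} (Fn : ℂ → Hv → ℂ) (n12 : ℂ → ℂ) (R : ℂ → Hv → ℂ)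
    (hn12 : ContinuousAt n12 (1 / 2)) (hR : ∀ hv, ContinuousAt (fun s => R s hv) (1 / 2))
    (hread : ∀ s : ℂ, 0 < s.re → ∀ hv, Fn s hv = n12 s * R s hv) (hv : Hv) :
    ContinuousAt (fun s => Fn s hv) (1 / 2) := by
  have hhalf : 0 < (1 / 2 : ℂ).re := by norm_num
  have hnhds : {s : ℂ | 0 < s.re} ∈ 𝓝 (1 / 2 : ℂ) := (isOpen_lt continuous_const Complex.continuous_re).mem_nhds hhalf
  refine (hn12.mul (hR hv)).congr ?_
  filter_upwards [hnhds] with s hs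
  exact (hread s hs hv).symm

/-- **THE ARCH KERNEL FROM THE TOWER LETTERS, FAMILY FORM** (the tower data indexed by the type `ι`, `kof : Hv → ι` the type of the arch datum): per type `i` the letters
`(nΔ i, n1 i, n12 i)` with `hcoc`, `hn1`, `hΔ`, and the reading `Fn s hv = n12 (kof hv) s · R s hv` ⊢ `∀ hv, Fn ½ hv = 0`. [cite: KudlaRallis1994, §2] -/
theorem archKernel_half_eq_zero_of_tower_letters_family {Hv ι : Type*} (kof : Hv → ι) (Fn : ℂ → Hv → ℂ) (nΔ n1 n12 : ι → ℂ → ℂ) (R : ℂ → Hv → ℂ)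
    (hcoc : ∀ i, ∀ s : ℂ, 0 < s.re → nΔ i s = n1 i (s - 1 / 2) * n12 i s) (hn1 : ∀ i, n1 i 0 ≠ 0) (hΔ : ∀ i, nΔ i (1 / 2) = 0)
    (hread : ∀ s : ℂ, 0 < s.re → ∀ hv, Fn s hv = n12 (kof hv) s * R s hv) :
    ∀ hv, Fn (1 / 2) hv = 0 := fun hv =>
  archKernel_half_eq_zero_of_tower_letters (Hv := Unit) (fun s _ => Fn s hv) (nΔ (kof hv)) (n1 (kof hv)) (n12 (kof hv)) (fun s _ => R s hv)
    (hcoc (kof hv)) (hn1 (kof hv)) (hΔ (kof hv)) (fun s hs _ => hread s hs hv) ()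

end Summit.HodgeConjecture.HodgeConjecture.Cruxes.HLiu418.K2LiuLocalKernelArchPlaceFactor

end
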